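import Mathlib
import HarnessLib
import Summits.Ventures.LatticeQCDFlow.Scoring.QuantileBand

/-!
# DISTRIBUTION-FREE CONFIDENCE BRACKETS FOR ALL POPULATION QUANTILES AT ONCE: on the
# Glivenko–Cantelli band event every population quantile is bracketed by two EMPIRICAL quantiles,
# `q̂ₙ(u − ε) ≤ q_F(u) ≤ q̂ₙ(u + ε)` for all `u ∈ (ε, 1 − ε)`, except with probability at most
# `2(⌈2/ε⌉ + 1)·e^{−nε²/2}`

HONEST FRAMING: exact (Metropolis-corrected) sampling algorithms for lattice gauge theory;
figures of merit are autocorrelation/cost numbers at stated couplings and volumes; no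
continuum-physics claim.

Venture `LatticeQCDFlow` (cell pub-lqcd), topic `Scoring`; FANOUT row 4 (`s0-u1-b`, rung S0-B).
`Scoring/QuantileBand` proved the ESTIMATION bracket `q_F(u − ε) ≤ q̂ₙ(u) ≤ q_F(u + ε)` (where the
empirical quantile can be, given the population ones).  A card needs the converse reading — an
INTERVAL for the unknown population quantile built from printed order statistics: since the
deterministic lemma `QuantileBand.quantile_bracket_of_abs_cdf_sub_lt` is symmetric in the two
measures, the same Glivenko–Cantelli band event gives `q̂ₙ(u − ε) ≤ q_F(u) ≤ q̂ₙ(u + ε)` for every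
`u ∈ (ε, 1 − ε)` simultaneously — a distribution-free confidence statement for the whole percentile
table (the classical order-statistic interval for a quantile, in uniform finite-sample form; no
density, no atoms excluded).  **`measureReal_exists_quantile_notMem_bracket_le`**: for iid real
`Xᵢ`, `ε > 0`, `n ≥ 1`,
`P(∃ u ∈ (ε, 1 − ε), ¬(q̂ₙ(u − ε) ≤ q_F(u) ≤ q̂ₙ(u + ε))) ≤ 2(⌈2/ε⌉ + 1)·e^{−nε²/2}`.
The Markov-chain version (Doeblin certificate, any start) is `Scoring/ChainQuantileConfidenceBracket`.
NEW WORK of the cell; no definition; nothing cited as a fact (printed counterpart NAMED ONLY: the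
order-statistic confidence interval for a quantile, e.g. David–Nagaraja, *Order Statistics* §7.1).

## Content

* **`measureReal_exists_quantile_notMem_bracket_le`**.

NOT CLAIMED: the exact binomial (non-asymptotic, non-uniform) order-statistic interval; sharp
constants; dependent draws (see the chain file).
-/

noncomputable section

namespace Summit.Ventures.LatticeQCDFlow.Scoring.GlivenkoCantelli

open MeasureTheory ProbabilityTheory Finset Filter Function
open scoped Topology ENNReal

variable {Ω : Type*} [MeasurableSpace Ω] {P : Measure Ω} [IsProbabilityMeasure P] {X : ℕ → Ω → ℝ}

/-- **ALL POPULATION QUANTILES BRACKETED BY EMPIRICAL QUANTILES AT ONCE.**  iid real `Xᵢ` with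
law `ρ = P ∘ X₀⁻¹`, population lower quantiles `q_F(u) = inf{x : u ≤ cdf ρ x}`, empirical lower
quantiles `q̂ₙ(v) = inf{x : v ≤ cdf(n⁻¹Σ_{i<n} δ_{Xᵢ}) x}`; `ε > 0`, `n ≥ 1`.  Then
`P(∃ u, ε < u ∧ u + ε < 1 ∧ ¬(q̂ₙ(u − ε) ≤ q_F(u) ≤ q̂ₙ(u + ε))) ≤ 2(⌈2/ε⌉ + 1)·e^{−nε²/2}`.
[ours] (on the complement of the Glivenko–Cantelli band event every bracket holds, by
`quantile_bracket_of_abs_cdf_sub_lt` applied to the empirical measure and `ρ`) -/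
theorem measureReal_exists_quantile_notMem_bracket_le (hXm : ∀ i, Measurable (X i))
    (hind : iIndepFun X P) (hid : ∀ i, IdentDistrib (X i) (X 0) P P) {ε : ℝ} (hε : 0 < ε)
    {n : ℕ} (hn : 1 ≤ n) :
    P.real {ω | ∃ u : ℝ, ε < u ∧ u + ε < 1 ∧
        ¬ (sInf {x | u - ε ≤ cdf (((n : ℝ≥0∞)⁻¹) • ∑ i ∈ range n, Measure.dirac (X i ω)) x}
              ≤ sInf {x | u ≤ cdf (P.map (X 0)) x}
            ∧ sInf {x | u ≤ cdf (P.map (X 0)) x}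
              ≤ sInf {x | u + ε ≤ cdf (((n : ℝ≥0∞)⁻¹) • ∑ i ∈ range n, Measure.dirac (X i ω)) x})}
      ≤ 2 * ((⌈2 / ε⌉₊ : ℝ) + 1) * Real.exp (-(n * ε ^ 2 / 2)) := by
  haveI : IsProbabilityMeasure (P.map (X 0)) :=
    Measure.isProbabilityMeasure_map (hXm 0).aemeasurable
  refine le_trans (measureReal_mono ?_ (measure_ne_top P _))
    (measureReal_exists_edf_dev_ge_le_of_pos hXm hind hid hε hn)
  rintro ω ⟨u, hεu, huε, hnot⟩
  by_contra hgood
  simp only [Set.mem_setOf_eq, not_exists, not_le] at hgood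
  haveI := isProbabilityMeasure_empiricalMeasure (fun i => X i ω) hn
  refine hnot (quantile_bracket_of_abs_cdf_sub_lt
    (((n : ℝ≥0∞)⁻¹) • ∑ i ∈ range n, Measure.dirac (X i ω)) (P.map (X 0)) hε hεu huε fun t => ?_)
  rw [cdf_empiricalMeasure (fun i => X i ω) hn t, abs_sub_comm]
  exact hgood t

end Summit.Ventures.LatticeQCDFlow.Scoring.GlivenkoCantelli

end
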